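import Summits.AtomisticToContinuum.FouriersLaw.Theorems.EmbeddedDrudeMourreNessUniqueIBP
import Summits.AtomisticToContinuum.FouriersLaw.Theorems.EmbeddedDrudeMourreNessUniqueCutoff

/-!
# Uniqueness of the weak steady state (`NessUnique`), part 3: profiles and the truncations `χ(H/R) m_M(ρ)`

Support file for item `stmt-AtomisticToContinuum-0741` (`EmbeddedDrudeMourre.NessUnique`). Two one-variable
profiles, written as explicit primitives (no definitions are introduced), and the truncations built from them:

* the **height truncation** `m_M(s) = ∫₀ˢ χ(σ/M) dσ` (`χ = smoothCutoff`, `M > 0`): `C²`, concave,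
  `m_M(s) = s` for `s ≤ M`, `m_M' = χ(·/M) ∈ [0, 1]` vanishing on `[2M, ∞)`, and on `s ≥ 0`:
  `0 ≤ m_M(s) ≤ s`, `0 ≤ m_M(s) - s m_M'(s)`;
* the **Fisher profile** `F_δ(s) = ∫₀ˢ arctan(arsinh(σ/δ)) dσ` (`δ > 0`): `F_δ' ∈ [0, π/2)` on `s ≥ 0`,
  increasing, `F_δ''(s) = [(1 + arsinh²(s/δ)) δ √(1 + (s/δ)²)]⁻¹ > 0`, so that `F_δ'` is bounded while
  `1/F_δ''(s) ≤ (1 + arsinh²(S₀/δ))(s + δ)` on `[0, S₀]` (`abs_le_amgm_fisherCurv`: the AM–GM step used to trade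
  `|∂ρ|` for the weighted Fisher information);
* for a `C²` solution `ρ ≥ 0` of `L̂ρ + 2γρ = 0`, the compactly supported `C²` truncations
  `f_{R,M} = χ(H/R) · m_M(ρ)` have the stationary defect
  `L̂ f + 2γ f = a [2γ (m(ρ) - ρ m'(ρ)) + ½ m''(ρ) Γ(ρ,ρ)] + m(ρ) L̂ a + m'(ρ) Γ(a, ρ)`, `a = χ(H/R)`
  (`revGenerator_truncation_add_eq`), whence the pointwise bound
  `|L̂ f + 2γ f| ≤ 2γ θ_M(ρ) + ½ a (-m''(ρ)) Γ(ρ,ρ) + ρ |L̂ a| + m'(ρ) |Γ(a,ρ)|`, `θ_M(s) = s[M < s]`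
  (`abs_revGenerator_truncation_add_le`).
-/

noncomputable section

open MeasureTheory ProbabilityTheory Filter Topology Set
open scoped ContDiff NNReal ENNReal

namespace Summit.AtomisticToContinuum.FouriersLaw.Theorems.NessUnique

open Literature.MathematicalPhysics.KineticTheory.HeatConduction
open Literature.MathematicalPhysics.KineticTheory Literature.Probability.Process OscillatorChain
open Literature.Analysis.Distribution
open Summit.AtomisticToContinuum.FouriersLaw.Theorems.SubdiffusiveBondHeat

/-! ### The height truncation `m_M(s) = ∫₀ˢ χ(σ/M) dσ` -/

section Height

variable {M : ℝ} (hM : 0 < M)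

/-- `m_M' = χ(·/M)`. [folklore] -/
theorem hasDerivAt_heightProfile (M s : ℝ) :
    HasDerivAt (fun s => ∫ σ in (0:ℝ)..s, smoothCutoff (σ / M)) (smoothCutoff (s / M)) s :=
  ((contDiff_smoothCutoff (n := 0)).continuous.comp (continuous_id.div_const M)
    |>.integral_hasStrictDerivAt 0 s).hasDerivAt

/-- The height truncation is `C²`. [folklore] -/
theorem contDiff_two_heightProfile (M : ℝ) : ContDiff ℝ 2 fun s => ∫ σ in (0:ℝ)..s, smoothCutoff (σ / M) :=
  contDiff_two_of_hasDerivAt (hasDerivAt_heightProfile M) (hasDerivAt_cutoffProfile M)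
    (((contDiff_smoothCutoff (n := 1)).continuous_deriv le_rfl).comp (continuous_id.div_const M)
      |>.div_const M)

/-- `0 ≤ m_M(s) ≤ s` for `s ≥ 0`. [folklore] -/
theorem heightProfile_mem_Icc (M : ℝ) {s : ℝ} (hs : 0 ≤ s) :
    (∫ σ in (0:ℝ)..s, smoothCutoff (σ / M)) ∈ Icc (0 : ℝ) s := by
  constructor
  · exact intervalIntegral.integral_nonneg hs fun σ _ => smoothCutoff_nonneg _
  · have h : ∫ σ in (0:ℝ)..s, smoothCutoff (σ / M) ≤ ∫ _ in (0:ℝ)..s, (1 : ℝ) :=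
      intervalIntegral.integral_mono_on hs
        (((contDiff_smoothCutoff (n := 0)).continuous.comp (continuous_id.div_const M)).intervalIntegrable _ _)
        intervalIntegrable_const fun σ _ => smoothCutoff_le_one _
    rw [intervalIntegral.integral_const, smul_eq_mul, mul_one, sub_zero] at h
    exact h

include hM

/-- `m_M(s) = s` for `s ≤ M`. [folklore] -/
theorem heightProfile_eq_self {s : ℝ} (hs : s ≤ M) : ∫ σ in (0:ℝ)..s, smoothCutoff (σ / M) = s := by
  have h : ∫ σ in (0:ℝ)..s, smoothCutoff (σ / M) = ∫ _ in (0:ℝ)..s, (1 : ℝ) := by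
    refine intervalIntegral.integral_congr fun σ hσ => ?_
    have hσ' : σ ≤ M := by
      have := hσ.2
      rcases le_total 0 s with h0 | h0
      · rw [max_eq_right h0] at this; exact this.trans hs
      · rw [max_eq_left h0] at this; exact this.trans hM.le
    exact smoothCutoff_of_le_one ((div_le_one hM).2 hσ')
  rw [h, intervalIntegral.integral_const, smul_eq_mul, mul_one, sub_zero]

/-- `s m_M'(s) ≤ m_M(s)` for `s ≥ 0` (concavity: `χ` is antitone). [folklore] -/
theorem mul_deriv_le_heightProfile {s : ℝ} (hs : 0 ≤ s) :
    s * smoothCutoff (s / M) ≤ ∫ σ in (0:ℝ)..s, smoothCutoff (σ / M) := by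
  have h : ∫ _ in (0:ℝ)..s, smoothCutoff (s / M) ≤ ∫ σ in (0:ℝ)..s, smoothCutoff (σ / M) :=
    intervalIntegral.integral_mono_on hs intervalIntegrable_const
      (((contDiff_smoothCutoff (n := 0)).continuous.comp (continuous_id.div_const M)).intervalIntegrable _ _)
      fun σ hσ => antitone_smoothCutoff (div_le_div_of_nonneg_right hσ.2 hM.le)
  rw [intervalIntegral.integral_const, smul_eq_mul, sub_zero] at h
  linarith [h]

/-- `m_M' = χ(s/M) = 1` for `s ≤ M`. [folklore] -/
theorem deriv_heightProfile_eq_one {s : ℝ} (hs : s ≤ M) : smoothCutoff (s / M) = 1 :=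
  smoothCutoff_of_le_one ((div_le_one hM).2 hs)

/-- `m_M' = χ(s/M) = 0` for `s ≥ 2M`. [folklore] -/
theorem deriv_heightProfile_eq_zero {s : ℝ} (hs : 2 * M ≤ s) : smoothCutoff (s / M) = 0 :=
  smoothCutoff_of_two_le ((le_div_iff₀ hM).2 hs)

/-- `m_M'' = χ'(s/M)/M ≤ 0`. [folklore] -/
theorem deriv_deriv_heightProfile_nonpos (s : ℝ) : deriv smoothCutoff (s / M) / M ≤ 0 :=
  div_nonpos_of_nonpos_of_nonneg (deriv_smoothCutoff_nonpos _) hM.le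

/-- **The profile `F(s) = s - m_M(s)` of the height truncation**: on `s ≥ 0`,
`0 ≤ F(s) ≤ θ_M(s)` and `0 ≤ s F'(s) - F(s) ≤ θ_M(s)` with `θ_M(s) = s·[M < s]`
(both vanish on `[0, M]`). [folklore] -/
theorem sub_heightProfile_bounds {s : ℝ} (hs : 0 ≤ s) :
    0 ≤ s - ∫ σ in (0:ℝ)..s, smoothCutoff (σ / M) ∧
    s - (∫ σ in (0:ℝ)..s, smoothCutoff (σ / M)) ≤ 1 * (if M < s then s else 0) ∧
    0 ≤ s * (1 - smoothCutoff (s / M)) - (s - ∫ σ in (0:ℝ)..s, smoothCutoff (σ / M)) ∧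
    s * (1 - smoothCutoff (s / M)) - (s - ∫ σ in (0:ℝ)..s, smoothCutoff (σ / M)) ≤
      1 * (if M < s then s else 0) := by
  have h1 := heightProfile_mem_Icc M hs
  have h2 := mul_deriv_le_heightProfile hM hs
  refine ⟨by linarith [h1.2], ?_, by nlinarith [h2], ?_⟩
  · split_ifs with h
    · linarith [h1.1]
    · rw [heightProfile_eq_self hM (not_lt.1 h)]; simp
  · split_ifs with h
    · have : 0 ≤ s * smoothCutoff (s / M) := mul_nonneg hs (smoothCutoff_nonneg _)
      nlinarith [h1.2]
    · rw [heightProfile_eq_self hM (not_lt.1 h), deriv_heightProfile_eq_one hM (not_lt.1 h)]; simp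

end Height

/-! ### The Fisher profile `F_δ(s) = ∫₀ˢ arctan(arsinh(σ/δ)) dσ` -/

section Fisher

/-- The slope `F_δ'(s) = arctan(arsinh(s/δ))` is continuous. [folklore] -/
theorem continuous_fisherSlope (δ : ℝ) : Continuous fun s : ℝ => Real.arctan (Real.arsinh (s / δ)) :=
  Real.continuous_arctan.comp (Real.continuous_arsinh.comp (continuous_id.div_const δ))

/-- `F_δ' = arctan(arsinh(·/δ))`. [folklore] -/
theorem hasDerivAt_fisherProfile (δ s : ℝ) :
    HasDerivAt (fun s => ∫ σ in (0:ℝ)..s, Real.arctan (Real.arsinh (σ / δ)))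
      (Real.arctan (Real.arsinh (s / δ))) s :=
  ((continuous_fisherSlope δ).integral_hasStrictDerivAt 0 s).hasDerivAt

/-- `F_δ''(s) = (1 + arsinh²(s/δ))⁻¹ · (√(1 + (s/δ)²))⁻¹ · δ⁻¹`. [folklore] -/
theorem hasDerivAt_fisherSlope (δ s : ℝ) :
    HasDerivAt (fun s : ℝ => Real.arctan (Real.arsinh (s / δ)))
      (1 / (1 + Real.arsinh (s / δ) ^ 2) * ((Real.sqrt (1 + (s / δ) ^ 2))⁻¹ * (1 / δ))) s := by
  have h1 : HasDerivAt (fun s : ℝ => s / δ) (1 / δ) s := by simpa using (hasDerivAt_id s).div_const δ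
  have h2 := (Real.hasDerivAt_arsinh (s / δ)).comp s h1
  have h3 := (Real.hasDerivAt_arctan (Real.arsinh (s / δ))).comp s h2
  simpa [Function.comp_def] using h3

/-- `F_δ''` is continuous. [folklore] -/
theorem continuous_fisherCurv (δ : ℝ) :
    Continuous fun s : ℝ => 1 / (1 + Real.arsinh (s / δ) ^ 2) * ((Real.sqrt (1 + (s / δ) ^ 2))⁻¹ * (1 / δ)) := by
  refine Continuous.mul ?_ ((Continuous.inv₀ ?_ fun s => ?_).mul continuous_const)
  · refine continuous_const.div (continuous_const.add ((Real.continuous_arsinh.comp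
      (continuous_id.div_const δ)).pow 2)) fun s => ?_
    positivity
  · exact Real.continuous_sqrt.comp (continuous_const.add ((continuous_id.div_const δ).pow 2))
  · exact (Real.sqrt_pos.2 (by positivity)).ne'

variable {δ : ℝ} (hδ : 0 < δ)
include hδ

/-- `F_δ'' > 0`. [folklore] -/
theorem fisherCurv_pos (s : ℝ) :
    0 < 1 / (1 + Real.arsinh (s / δ) ^ 2) * ((Real.sqrt (1 + (s / δ) ^ 2))⁻¹ * (1 / δ)) := by
  have h1 : 0 < Real.sqrt (1 + (s / δ) ^ 2) := Real.sqrt_pos.2 (by positivity)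
  positivity

/-- The slope is monotone. [folklore] -/
theorem monotone_fisherSlope : Monotone fun s : ℝ => Real.arctan (Real.arsinh (s / δ)) :=
  fun _ _ h => Real.arctan_mono (Real.arsinh_le_arsinh.2 (div_le_div_of_nonneg_right h hδ.le))

/-- `0 ≤ F_δ'(s) ≤ π/2` for `s ≥ 0`. [folklore] -/
theorem fisherSlope_mem_Icc {s : ℝ} (hs : 0 ≤ s) :
    Real.arctan (Real.arsinh (s / δ)) ∈ Icc (0 : ℝ) (Real.pi / 2) :=
  ⟨Real.arctan_nonneg.2 (Real.arsinh_nonneg_iff.2 (div_nonneg hs hδ.le)), (Real.arctan_lt_pi_div_two _).le⟩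

/-- **The bounds on the Fisher profile**: on `s ≥ 0`, `0 ≤ F_δ(s) ≤ (π/2) s` and
`0 ≤ s F_δ'(s) - F_δ(s) ≤ (π/2) s`. [folklore] -/
theorem fisherProfile_bounds {s : ℝ} (hs : 0 ≤ s) :
    0 ≤ ∫ σ in (0:ℝ)..s, Real.arctan (Real.arsinh (σ / δ)) ∧
    (∫ σ in (0:ℝ)..s, Real.arctan (Real.arsinh (σ / δ))) ≤ Real.pi / 2 * s ∧
    0 ≤ s * Real.arctan (Real.arsinh (s / δ)) - ∫ σ in (0:ℝ)..s, Real.arctan (Real.arsinh (σ / δ)) ∧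
    s * Real.arctan (Real.arsinh (s / δ)) - (∫ σ in (0:ℝ)..s, Real.arctan (Real.arsinh (σ / δ))) ≤
      Real.pi / 2 * s := by
  have hint : IntervalIntegrable (fun σ : ℝ => Real.arctan (Real.arsinh (σ / δ))) volume 0 s :=
    (continuous_fisherSlope δ).intervalIntegrable _ _
  have h0 : 0 ≤ ∫ σ in (0:ℝ)..s, Real.arctan (Real.arsinh (σ / δ)) :=
    intervalIntegral.integral_nonneg hs fun σ hσ => (fisherSlope_mem_Icc hδ hσ.1).1
  have h1 : ∫ σ in (0:ℝ)..s, Real.arctan (Real.arsinh (σ / δ)) ≤ ∫ _ in (0:ℝ)..s, Real.pi / 2 :=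
    intervalIntegral.integral_mono_on hs hint intervalIntegrable_const fun σ hσ =>
      (fisherSlope_mem_Icc hδ hσ.1).2
  have h3 : ∫ σ in (0:ℝ)..s, Real.arctan (Real.arsinh (σ / δ)) ≤
      ∫ _ in (0:ℝ)..s, Real.arctan (Real.arsinh (s / δ)) :=
    intervalIntegral.integral_mono_on hs hint intervalIntegrable_const fun σ hσ =>
      monotone_fisherSlope hδ hσ.2
  have h5 : ∫ _ in (0:ℝ)..s, (0 : ℝ) ≤ ∫ σ in (0:ℝ)..s, Real.arctan (Real.arsinh (σ / δ)) :=
    intervalIntegral.integral_mono_on hs intervalIntegrable_const hint fun σ hσ =>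
      (fisherSlope_mem_Icc hδ hσ.1).1
  rw [intervalIntegral.integral_const, smul_eq_mul, sub_zero] at h1 h3 h5
  have h4 := fisherSlope_mem_Icc hδ hs
  refine ⟨h0, by linarith, by linarith, ?_⟩
  nlinarith [h4.1, h4.2, h5]

/-- **The reciprocal curvature bound**: for `0 ≤ s ≤ S₀`,
`1 / F_δ''(s) ≤ (1 + arsinh²(S₀/δ)) (s + δ)` (`δ√(1 + (s/δ)²) = √(δ² + s²) ≤ s + δ`). [folklore] -/
theorem inv_fisherCurv_le {s S₀ : ℝ} (hs : 0 ≤ s) (hsS : s ≤ S₀) :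
    1 / (1 / (1 + Real.arsinh (s / δ) ^ 2) * ((Real.sqrt (1 + (s / δ) ^ 2))⁻¹ * (1 / δ))) ≤
      (1 + Real.arsinh (S₀ / δ) ^ 2) * (s + δ) := by
  have hsq : Real.sqrt (1 + (s / δ) ^ 2) ≤ (s + δ) / δ := by
    refine Real.sqrt_le_iff.2 ⟨by positivity, ?_⟩
    have e : (s + δ) / δ = s / δ + 1 := by field_simp
    rw [e]
    nlinarith [div_nonneg hs hδ.le]
  have hsq0 : 0 < Real.sqrt (1 + (s / δ) ^ 2) := Real.sqrt_pos.2 (by positivity)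
  have ha0 : 0 ≤ Real.arsinh (s / δ) := Real.arsinh_nonneg_iff.2 (div_nonneg hs hδ.le)
  have ha : Real.arsinh (s / δ) ≤ Real.arsinh (S₀ / δ) :=
    Real.arsinh_le_arsinh.2 (div_le_div_of_nonneg_right hsS hδ.le)
  have ha2 : Real.arsinh (s / δ) ^ 2 ≤ Real.arsinh (S₀ / δ) ^ 2 := pow_le_pow_left₀ ha0 ha 2
  have e : 1 / (1 / (1 + Real.arsinh (s / δ) ^ 2) * ((Real.sqrt (1 + (s / δ) ^ 2))⁻¹ * (1 / δ))) =
      (1 + Real.arsinh (s / δ) ^ 2) * (Real.sqrt (1 + (s / δ) ^ 2) * δ) := by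
    field_simp
  rw [e]
  have hb : Real.sqrt (1 + (s / δ) ^ 2) * δ ≤ s + δ := by
    have := mul_le_mul_of_nonneg_right hsq hδ.le
    rwa [div_mul_cancel₀ _ hδ.ne'] at this
  exact mul_le_mul (by linarith) hb (by positivity) (by positivity)

/-- **AM–GM with the Fisher curvature**: for `0 ≤ s ≤ S₀`, `ε > 0` and any `y`,
`|y| ≤ ½ (ε (1 + arsinh²(S₀/δ)) (s + δ) + F_δ''(s) y² / ε)`. [folklore] -/
theorem abs_le_amgm_fisherCurv {s S₀ ε : ℝ} (hs : 0 ≤ s) (hsS : s ≤ S₀) (hε : 0 < ε) (y : ℝ) :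
    |y| ≤ (ε * ((1 + Real.arsinh (S₀ / δ) ^ 2) * (s + δ)) +
      (1 / (1 + Real.arsinh (s / δ) ^ 2) * ((Real.sqrt (1 + (s / δ) ^ 2))⁻¹ * (1 / δ))) * y ^ 2 / ε) / 2 := by
  set c := 1 / (1 + Real.arsinh (s / δ) ^ 2) * ((Real.sqrt (1 + (s / δ) ^ 2))⁻¹ * (1 / δ)) with hc
  have hc0 : 0 < c := fisherCurv_pos hδ s
  set u := ε / c with hu
  have hu0 : 0 < u := div_pos hε hc0
  -- `2|y| ≤ u + y²/u`
  have hamgm : 2 * |y| ≤ u + y ^ 2 / u := by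
    rw [← sub_nonneg]
    have e : u + y ^ 2 / u - 2 * |y| = (u - |y|) ^ 2 / u := by
      field_simp
      rw [← sq_abs y]; ring
    rw [e]; positivity
  have hu1 : u ≤ ε * ((1 + Real.arsinh (S₀ / δ) ^ 2) * (s + δ)) := by
    rw [hu, div_eq_mul_one_div]
    exact mul_le_mul_of_nonneg_left (inv_fisherCurv_le hδ hs hsS) hε.le
  have hu2 : y ^ 2 / u = c * y ^ 2 / ε := by
    rw [hu]; field_simp
  rw [hu2] at hamgm
  linarith

end Fisher

/-! ### The truncations `f = χ(H/R) m_M(ρ)` and their stationary defect -/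

section Pointwise

variable {N : ℕ} {P : OscillatorChain}

variable {T_L T_R : ℝ} {ρ : PhaseSpace N → ℝ}

/-- The truncation has compact support (confining potentials, `R > 0`). [folklore] -/
theorem hasCompactSupport_truncation (hP : P.IsConfining) (M : ℝ) {R : ℝ} (hR : 0 < R) :
    HasCompactSupport fun y => smoothCutoff (P.hamiltonian N y / R) *
      ∫ σ in (0:ℝ)..ρ y, smoothCutoff (σ / M) :=
  (hasCompactSupport_energyCutoff hP N hR).mul_right

/-- `0 ≤ f ≤ ρ` for `ρ ≥ 0`. [folklore] -/
theorem truncation_mem_Icc (hρ0 : ∀ x, 0 ≤ ρ x) (M R : ℝ) (x : PhaseSpace N) :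
    smoothCutoff (P.hamiltonian N x / R) * (∫ σ in (0:ℝ)..ρ x, smoothCutoff (σ / M)) ∈ Icc 0 (ρ x) := by
  have h := heightProfile_mem_Icc M (hρ0 x)
  have ha := energyCutoff_mem_Icc (P := P) R x
  exact ⟨mul_nonneg ha.1 h.1, (mul_le_of_le_one_left h.1 ha.2).trans h.2⟩

variable (hU : ContDiff ℝ 2 P.U) (hV : ContDiff ℝ 2 P.V) (hρ : ContDiff ℝ 2 ρ)
  (hpde : ∀ x, sdeGenerator (fun y => -P.drift N y) (P.bathVecL N T_L) (P.bathVecR N T_R) ρ x +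
    2 * P.γ * ρ x = 0)
include hU hV hρ

/-- The truncation `f = χ(H/R) m_M(ρ)` is `C²`. [folklore] -/
theorem contDiff_truncation (M R : ℝ) :
    ContDiff ℝ 2 fun y => smoothCutoff (P.hamiltonian N y / R) *
      ∫ σ in (0:ℝ)..ρ y, smoothCutoff (σ / M) :=
  (contDiff_energyCutoff hU hV N R).mul ((contDiff_two_heightProfile M).comp hρ)

include hpde

/-- **The stationary defect of the truncation**, pointwise:
`L̂ f + 2γ f = a [2γ (m(ρ) - ρ m'(ρ)) + ½ m''(ρ) Γ(ρ,ρ)] + m(ρ) L̂ a + m'(ρ) Γ(a, ρ)`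
with `a = χ(H/R)`, `m = m_M`, `m' = χ(·/M)`, `m'' = χ'(·/M)/M`. [folklore] -/
theorem revGenerator_truncation_add_eq (M R : ℝ) (x : PhaseSpace N) :
    sdeGenerator (fun y => -P.drift N y) (P.bathVecL N T_L) (P.bathVecR N T_R)
        (fun y => smoothCutoff (P.hamiltonian N y / R) * ∫ σ in (0:ℝ)..ρ y, smoothCutoff (σ / M)) x +
      2 * P.γ * (smoothCutoff (P.hamiltonian N x / R) * ∫ σ in (0:ℝ)..ρ x, smoothCutoff (σ / M)) =
    smoothCutoff (P.hamiltonian N x / R) *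
        (2 * P.γ * ((∫ σ in (0:ℝ)..ρ x, smoothCutoff (σ / M)) - ρ x * smoothCutoff (ρ x / M)) +
          (1 / 2) * (deriv smoothCutoff (ρ x / M) / M) *
            carreDuChamp (P.bathVecL N T_L) (P.bathVecR N T_R) ρ ρ x) +
      (∫ σ in (0:ℝ)..ρ x, smoothCutoff (σ / M)) *
        sdeGenerator (fun y => -P.drift N y) (P.bathVecL N T_L) (P.bathVecR N T_R)
          (fun y => smoothCutoff (P.hamiltonian N y / R)) x +
      smoothCutoff (ρ x / M) *
        carreDuChamp (P.bathVecL N T_L) (P.bathVecR N T_R)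
          (fun y => smoothCutoff (P.hamiltonian N y / R)) ρ x := by
  set vL := P.bathVecL N T_L
  set vR := P.bathVecR N T_R
  set a : PhaseSpace N → ℝ := fun y => smoothCutoff (P.hamiltonian N y / R) with ha
  set m : ℝ → ℝ := fun s => ∫ σ in (0:ℝ)..s, smoothCutoff (σ / M) with hm
  have ha2 : ContDiff ℝ 2 a := contDiff_energyCutoff hU hV N R
  have hm2 : ContDiff ℝ 2 fun y => m (ρ y) := (contDiff_two_heightProfile M).comp hρ
  have hρd : Differentiable ℝ ρ := hρ.differentiable (by norm_num)
  have hprod := sdeGenerator_mul' (fun y => -P.drift N y) vL vR ha2 hm2 x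
  have hcomp := sdeGenerator_comp_eq (fun y => -P.drift N y) vL vR (hasDerivAt_heightProfile M)
    (hasDerivAt_cutoffProfile M) hρ x
  have hΓ : carreDuChamp vL vR a (fun y => m (ρ y)) x = smoothCutoff (ρ x / M) * carreDuChamp vL vR a ρ x := by
    rw [carreDuChamp_comm, carreDuChamp_comp_left vL vR (hasDerivAt_heightProfile M) hρd a x,
      carreDuChamp_comm]
  have hLρ : sdeGenerator (fun y => -P.drift N y) vL vR ρ x = -(2 * P.γ * ρ x) := by
    have := hpde x; linarith
  show sdeGenerator (fun y => -P.drift N y) vL vR (fun y => a y * m (ρ y)) x + 2 * P.γ * (a x * m (ρ x)) =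
    a x * (2 * P.γ * (m (ρ x) - ρ x * smoothCutoff (ρ x / M)) +
      (1 / 2) * (deriv smoothCutoff (ρ x / M) / M) * carreDuChamp vL vR ρ ρ x) +
    m (ρ x) * sdeGenerator (fun y => -P.drift N y) vL vR a x + smoothCutoff (ρ x / M) * carreDuChamp vL vR a ρ x
  rw [hprod, hcomp, hΓ, hLρ]
  ring

/-- **Pointwise bound on the stationary defect**: for `ρ ≥ 0`, `M > 0`,
`|L̂ f + 2γ f| ≤ 2γ θ_M(ρ) + ½ a (-m''(ρ)) Γ(ρ,ρ) + ρ |L̂ a| + m'(ρ) |Γ(a,ρ)|`,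
`θ_M(s) = s [M < s]` (uses `0 ≤ a ≤ 1`, `0 ≤ m - ρ m' ≤ θ_M`, `m'' ≤ 0`, `Γ(ρ,ρ) ≥ 0`, `0 ≤ m ≤ ρ`,
`m' ≥ 0`, `γ ≥ 0`). [folklore] -/
theorem abs_revGenerator_truncation_add_le (hγ : 0 ≤ P.γ) (hρ0 : ∀ x, 0 ≤ ρ x) {M : ℝ} (hM : 0 < M)
    (R : ℝ) (x : PhaseSpace N) :
    |sdeGenerator (fun y => -P.drift N y) (P.bathVecL N T_L) (P.bathVecR N T_R)
        (fun y => smoothCutoff (P.hamiltonian N y / R) * ∫ σ in (0:ℝ)..ρ y, smoothCutoff (σ / M)) x +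
      2 * P.γ * (smoothCutoff (P.hamiltonian N x / R) * ∫ σ in (0:ℝ)..ρ x, smoothCutoff (σ / M))| ≤
    2 * P.γ * (if M < ρ x then ρ x else 0) +
      (1 / 2) * (smoothCutoff (P.hamiltonian N x / R) * (-(deriv smoothCutoff (ρ x / M) / M) *
        carreDuChamp (P.bathVecL N T_L) (P.bathVecR N T_R) ρ ρ x)) +
      ρ x * |sdeGenerator (fun y => -P.drift N y) (P.bathVecL N T_L) (P.bathVecR N T_R)
          (fun y => smoothCutoff (P.hamiltonian N y / R)) x| +
      smoothCutoff (ρ x / M) *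
        |carreDuChamp (P.bathVecL N T_L) (P.bathVecR N T_R)
          (fun y => smoothCutoff (P.hamiltonian N y / R)) ρ x| := by
  rw [revGenerator_truncation_add_eq hU hV hρ hpde M R x]
  set vL := P.bathVecL N T_L
  set vR := P.bathVecR N T_R
  set ax := smoothCutoff (P.hamiltonian N x / R)
  set mx := ∫ σ in (0:ℝ)..ρ x, smoothCutoff (σ / M)
  set m1 := smoothCutoff (ρ x / M)
  set m2 := deriv smoothCutoff (ρ x / M) / M
  set Γρ := carreDuChamp vL vR ρ ρ x
  set La := sdeGenerator (fun y => -P.drift N y) vL vR (fun y => smoothCutoff (P.hamiltonian N y / R)) x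
  set Γa := carreDuChamp vL vR (fun y => smoothCutoff (P.hamiltonian N y / R)) ρ x
  have hax := energyCutoff_mem_Icc (P := P) R x
  have hmx := heightProfile_mem_Icc M (hρ0 x)
  have hm1 : 0 ≤ m1 := smoothCutoff_nonneg _
  have hm2 : m2 ≤ 0 := deriv_deriv_heightProfile_nonpos hM _
  have hΓρ : 0 ≤ Γρ := carreDuChamp_self_nonneg vL vR ρ x
  obtain ⟨-, -, hG0, hGθ⟩ := sub_heightProfile_bounds hM (hρ0 x)
  have hG0' : 0 ≤ mx - ρ x * m1 := by simp only [mx, m1] at hG0 ⊢; linarith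
  have hGθ' : mx - ρ x * m1 ≤ (if M < ρ x then ρ x else 0) := by simp only [mx, m1] at hGθ ⊢; linarith
  have h2γ : 0 ≤ 2 * P.γ := by linarith
  -- term by term
  have t1 : |ax * (2 * P.γ * (mx - ρ x * m1))| ≤ 2 * P.γ * (if M < ρ x then ρ x else 0) := by
    rw [abs_of_nonneg (mul_nonneg hax.1 (mul_nonneg h2γ hG0'))]
    calc ax * (2 * P.γ * (mx - ρ x * m1)) ≤ 1 * (2 * P.γ * (mx - ρ x * m1)) :=
          mul_le_mul_of_nonneg_right hax.2 (mul_nonneg h2γ hG0')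
      _ ≤ 2 * P.γ * (if M < ρ x then ρ x else 0) := by
          rw [one_mul]; exact mul_le_mul_of_nonneg_left hGθ' h2γ
  have t2 : |ax * ((1 / 2) * m2 * Γρ)| = (1 / 2) * (ax * (-m2 * Γρ)) := by
    rw [abs_of_nonpos]
    · ring
    · have : 0 ≤ ax * (-m2 * Γρ) := mul_nonneg hax.1 (mul_nonneg (by linarith) hΓρ)
      nlinarith
  have t3 : |mx * La| ≤ ρ x * |La| := by
    rw [abs_mul, abs_of_nonneg hmx.1]
    exact mul_le_mul_of_nonneg_right hmx.2 (abs_nonneg _)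
  have t4 : |m1 * Γa| = m1 * |Γa| := by rw [abs_mul, abs_of_nonneg hm1]
  calc |ax * (2 * P.γ * (mx - ρ x * m1) + (1 / 2) * m2 * Γρ) + mx * La + m1 * Γa|
      ≤ |ax * (2 * P.γ * (mx - ρ x * m1))| + |ax * ((1 / 2) * m2 * Γρ)| + |mx * La| + |m1 * Γa| := by
        have e : ax * (2 * P.γ * (mx - ρ x * m1) + (1 / 2) * m2 * Γρ) + mx * La + m1 * Γa =
            ax * (2 * P.γ * (mx - ρ x * m1)) + ax * ((1 / 2) * m2 * Γρ) + mx * La + m1 * Γa := by ring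
        rw [e]
        refine (abs_add_le _ _).trans (add_le_add ((abs_add_le _ _).trans (add_le_add ?_ le_rfl)) le_rfl)
        exact abs_add_le _ _
    _ ≤ 2 * P.γ * (if M < ρ x then ρ x else 0) + (1 / 2) * (ax * (-m2 * Γρ)) + ρ x * |La| + m1 * |Γa| := by
        rw [t2, t4]; linarith [t1, t3]

end Pointwise

end Summit.AtomisticToContinuum.FouriersLaw.Theorems.NessUnique

end
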